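import Summits.ValiantsHypothesis.ValiantsHypothesis.Theorems.KPlusLogSqLawTropicalGradedWalkPotD

/-!
# Route «KPlusLogSqLaw» — GRW-lite (all-`m` `K = 4` family): class lifts at a generic slope

HONEST FRAMING.  Helper file of the chain `--supports` the crux `Summit.ValiantsHypothesis.ValiantsHypothesis.Theses.KPlusLogSqLaw.TropicalB`
(item `stmt-ValiantsHypothesis-19771`, route `KPlusLogSqLaw`; cell `pub-symmetroid`, seat val-sym-trop-p3 g14).  Census-side construction
(`TropRootLawAt (n+1) 4`); nothing here bears on `TropicalB` in its window, `WeakLifting`, `MatrixDescartes` or `VP ≠ VNP`.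

CONTENT.  For a slope `θ` and a block cell of column `c` at level `E` the best rival class is determined by the position of `θ`
relative to `L·E`: ABOVE the slope (`θ ≤ L·E`, «future» levels) class `1` beats classes `2`, `3` by at least `1`; BELOW it
(`L·(E+1) ≤ θ`, «past» levels) class `3` beats classes `1`, `2` by at least `1`.  These generic lifts (`lift_fut2`, `lift_fut3`,
`lift_fut2_top`, `lift_fut3_top`, `lift_past1`, `lift_past2`) reduce the slack of every far rival to the slack of one class; they are
used by the dominance glue of the top states (`…DomTGlue*`) and of the later state types.
-/

set_option linter.dupNamespace false
set_option autoImplicit false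

namespace Summit.ValiantsHypothesis.ValiantsHypothesis.Theorems.LacunarySymmetroidMatrixDescartes.TropicalCensus

namespace GradedWalk

variable (n : ℕ)

/-- future levels: class `1` beats class `2`. -/
theorem lift_fut2 {θ : ℤ} {E : ℕ} (c : ℕ) (hθ : θ ≤ LL n * E) :
    θ * d2 n - (v1 n E c + bB n * tau2lt n E c) + 1 ≤ θ * d1 n - v1 n E c := by
  have hB : (2 : ℤ) ≤ bB n := by unfold bB; omega
  have hM : (0 : ℤ) ≤ MM n * c := by unfold MM; positivity
  have h1 : bB n * θ ≤ bB n * (LL n * E) := mul_le_mul_of_nonneg_left hθ (by linarith)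
  unfold d1 d2 tau2lt
  nlinarith [h1, hB, hM]

/-- future levels: class `1` beats class `3`. -/
theorem lift_fut3 {θ : ℤ} {E : ℕ} (c : ℕ) (hθ : θ ≤ LL n * E) :
    θ * d3 n - (v1 n E c + bB n * tau2lt n E c + tau3lt n E c) + 1 ≤ θ * d1 n - v1 n E c := by
  have hB : (2 : ℤ) ≤ bB n := by unfold bB; omega
  have hM : (0 : ℤ) ≤ MM n * c := by unfold MM; positivity
  have hME : (0 : ℤ) ≤ MM n * E := by unfold MM; positivity
  have h1 : (bB n + 1) * θ ≤ (bB n + 1) * (LL n * E) := mul_le_mul_of_nonneg_left hθ (by linarith)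
  unfold d1 d3 tau2lt tau3lt
  nlinarith [h1, hB, hM, hME]

/-- the top level `m`: class `1` beats class `2`. -/
theorem lift_fut2_top {θ : ℤ} (c : ℕ) (hθ : θ ≤ LL n * ((n : ℤ) + 1)) :
    θ * d2 n - (v1 n (n + 1) c + bB n * tau2 n (n + 1) c) + 1 ≤ θ * d1 n - v1 n (n + 1) c := by
  have hB : (2 : ℤ) ≤ bB n := by unfold bB; omega
  have hM : (0 : ℤ) ≤ M2 n * c := by unfold M2; positivity
  have h1 : bB n * θ ≤ bB n * (LL n * ((n : ℤ) + 1)) := mul_le_mul_of_nonneg_left hθ (by linarith)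
  unfold d1 d2 tau2
  rw [if_pos rfl]
  nlinarith [h1, hB, hM]

/-- the top level `m`: class `1` beats class `3`. -/
theorem lift_fut3_top {θ : ℤ} (c : ℕ) (hθ : θ ≤ LL n * ((n : ℤ) + 1)) :
    θ * d3 n - (v1 n (n + 1) c + bB n * tau2 n (n + 1) c + tau3 n (n + 1) c) + 1 ≤ θ * d1 n - v1 n (n + 1) c := by
  have hB : (2 : ℤ) ≤ bB n := by unfold bB; omega
  have hM : (0 : ℤ) ≤ M2 n * c := by unfold M2; positivity
  have hMn : (0 : ℤ) ≤ M2 n * ((n : ℤ) + 1) := by unfold M2; positivity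
  have h1 : (bB n + 1) * θ ≤ (bB n + 1) * (LL n * ((n : ℤ) + 1)) := mul_le_mul_of_nonneg_left hθ (by linarith)
  unfold d1 d3 tau2 tau3
  rw [if_pos rfl, if_pos rfl]
  nlinarith [h1, hB, hM, hMn]

/-- past levels: class `3` beats class `1`. -/
theorem lift_past1 {θ : ℤ} {E c : ℕ} (hc : c ≤ n) (hE : E ≤ n) (hθ : LL n * (E + 1) ≤ θ) :
    θ * d1 n - v1 n E c + 1 ≤ θ * d3 n - (v1 n E c + bB n * tau2lt n E c + tau3lt n E c) := by
  have hB : (2 : ℤ) ≤ bB n := by unfold bB; omega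
  have hcz : (c : ℤ) ≤ n := by exact_mod_cast hc
  have hEz : (E : ℤ) ≤ n := by exact_mod_cast hE
  have h1 : (bB n + 1) * (LL n * (E + 1)) ≤ (bB n + 1) * θ := mul_le_mul_of_nonneg_left hθ (by linarith)
  unfold d1 d3 tau2lt tau3lt
  unfold bB LL MM at *
  nlinarith [h1, hcz, hEz, mul_nonneg (show (0:ℤ) ≤ n by positivity) (show (0:ℤ) ≤ n by positivity),
    mul_nonneg (show (0:ℤ) ≤ n by positivity) (show (0:ℤ) ≤ (n:ℤ) - c by linarith),
    mul_nonneg (show (0:ℤ) ≤ n by positivity) (show (0:ℤ) ≤ (n:ℤ) - E by linarith),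
    mul_nonneg (mul_nonneg (show (0:ℤ) ≤ n by positivity) (show (0:ℤ) ≤ n by positivity)) (show (0:ℤ) ≤ (n:ℤ) - c by linarith)]

/-- past levels: class `3` beats class `2`. -/
theorem lift_past2 {θ : ℤ} {E c : ℕ} (hc : c ≤ n) (hE : E ≤ n) (hθ : LL n * (E + 1) ≤ θ) :
    θ * d2 n - (v1 n E c + bB n * tau2lt n E c) + 1 ≤ θ * d3 n - (v1 n E c + bB n * tau2lt n E c + tau3lt n E c) := by
  have hcz : (c : ℤ) ≤ n := by exact_mod_cast hc
  have hEz : (E : ℤ) ≤ n := by exact_mod_cast hE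
  unfold d2 d3 tau3lt
  unfold LL MM at *
  nlinarith [hθ, hcz, hEz, mul_nonneg (show (0:ℤ) ≤ n by positivity) (show (0:ℤ) ≤ (n:ℤ) - E by linarith),
    mul_nonneg (show (0:ℤ) ≤ n by positivity) (show (0:ℤ) ≤ n by positivity)]

end GradedWalk

end Summit.ValiantsHypothesis.ValiantsHypothesis.Theorems.LacunarySymmetroidMatrixDescartes.TropicalCensus
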